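import Summits.AtomisticToContinuum.BoseEinsteinCondensation.Theses.BECConjugateDomination
import Literature.MathematicalPhysics.QuantumManyBody.WeightedCorrector

/-!
# Triage note (r1, triager 2) on card `levy-spectrum-insertion-corrector`, crux stmt-AtomisticToContinuum-11784

The card's load-bearing stub `LevyCorrectorDomination` (copied VERBATIM below from
`Cruxes/InfraredMinimumUncertainty/IdeatorSketch-r1-k2.lean`, namespace `…Sketch2`) bounds the crux's
Lévy weight `ν_m` by the bath power of the FIRST massive corrector, whose sources `W_re`, `W_im` carry
the factor `vhat v k` (the BORN vertex `ṽ(k)`), and it quantifies over ALL correctors `δre`, `δim`.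
At a dual-lattice mode `k = 2πm/L` with `ṽ(k) = 0` the sources vanish, `δ ≡ 0` is a corrector, and the
stub therefore asserts `ν_m ≤ 0` there (`levyWeight_nonpos_at_bornZero`, kernel-checked below).
Smooth-class potentials with sign-changing `ṽ` exist (`v = V₀(1 − r²)₊⁴`: real zeros at
`kR₀ = 9.3558, 12.9665, 16.3547, …`, folder `compute/levy_uv_check.py`), while the dilute-gas UV Lévy
weight at such a mode is the pair-dressing tail `N ν_k ≈ ρ² A(k)²/(4k⁴ f₀) > 0` with the DRESSED
amplitude `A(k) = ∫ v f₀ e^{-ik·x}` (`A(k*)/A(0) = −9.3e−4, −7.1e−3, −2.8e−2` at the first zero for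
`V₀ = 1, 8, 40`): the typed stub is false inside the class unless restricted to an infrared window
`|k| ≤ K₀ √(ρ ṽ(0))` (where `ṽ > 0`). This file only certifies the LOGICAL half: stub ⇒ `ν ≤ 0` at
Born zeros.
-/

noncomputable section

open MeasureTheory Filter Set
open scoped ENNReal NNReal BigOperators

namespace Summit.AtomisticToContinuum.BoseEinsteinCondensation.Cruxes.InfraredMinimumUncertainty.TriageR1K2

open Literature.MathematicalPhysics.QuantumManyBody.BoseGas

/-- VERBATIM `Sketch2.IsMassiveWeakCorrector`. -/
def IsMassiveWeakCorrector {N : ℕ} (L : ℝ) (F : Config N → ℝ) (κ : ℝ) (g δ : Config N → ℝ) : Prop :=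
  IsPeriodicTest L δ ∧
    ∀ φ : Config N → ℝ, IsPeriodicTest L φ →
      dirichletFormW L F δ φ + κ * ∫ X in cellN N L, δ X * φ X * F X ^ 2 =
        ∫ X in cellN N L, g X * φ X * F X ^ 2

/-- VERBATIM `Sketch2.vhat`. -/
def vhat (v : ℝ → ℝ≥0∞) (k : Space) : ℝ :=
  ∫ x : Space, (v ‖x‖).toReal * Real.cos (∑ i : Fin 3, k i * x i)

/-- VERBATIM `Sketch2.LevyCorrectorDomination` (the card's crux stub). -/
def LevyCorrectorDomination : Prop :=
  ∀ v : ℝ → ℝ≥0∞, IsRepulsiveFiniteRange v → (∀ r, v r ≠ ⊤) →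
    ContDiff ℝ 2 (fun x : Space => (v ‖x‖).toReal) →
    (∃ Cₑ : ℝ, ∀ x : Space, ‖iteratedFDeriv ℝ 2 (fun x : Space => (v ‖x‖).toReal) x‖ ≤
      Cₑ * Real.sqrt ((v ‖x‖).toReal)) →
    ∃ C : ℝ, 0 ≤ C ∧ ∃ ρ₀ : ℝ, 0 < ρ₀ ∧ ∀ ρ : ℝ, 0 < ρ → ρ < ρ₀ → ∀ᶠ n : ℕ in atTop,
      ∀ Ψ : PeriodicTrialState (n + 1) (sideLength ρ (n + 1)),
      ∀ Θ : PeriodicTrialState n (sideLength ρ (n + 1)),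
      (let L : ℝ := sideLength ρ (n + 1)
       let g : Space → ℝ := fun r => ∫ x in cell L, ∫ Y in cellN n L,
         ‖Ψ.ψ (Matrix.vecCons (x + r) Y)‖ * ‖Ψ.ψ (Matrix.vecCons x Y)‖
       let ν : (Fin 3 → ℤ) → ℝ := fun m =>
         (cellFourierCoeff L (fun r : Space => ((Real.log (g r) : ℝ) : ℂ)) m).re
       periodicEnergy v Ψ = periodicGroundStateEnergy v (n + 1) L → periodicEnergy v Ψ ≠ ⊤ →
       (∀ X, Ψ.ψ X = (‖Ψ.ψ X‖ : ℂ)) → (∀ X, Ψ.ψ X ≠ 0) →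
       periodicEnergy v Θ = periodicGroundStateEnergy v n L → periodicEnergy v Θ ≠ ⊤ →
       (∀ Y, Θ.ψ Y = (‖Θ.ψ Y‖ : ℂ)) → (∀ Y, Θ.ψ Y ≠ 0) →
       ∀ m : Fin 3 → ℤ, m ≠ 0 →
        (let kv : Space := (2 * Real.pi / L) • latticeVec 1 m
         let FΘ : Config n → ℝ := fun Y => ‖Θ.ψ Y‖
         let Wre : Config n → ℝ := fun Y =>
           (L ^ 3)⁻¹ * vhat v kv * ∑ j : Fin n, Real.cos (∑ i : Fin 3, kv i * Y j i)
         let Wim : Config n → ℝ := fun Y =>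
           -((L ^ 3)⁻¹ * vhat v kv * ∑ j : Fin n, Real.sin (∑ i : Fin 3, kv i * Y j i))
         ∀ δre δim : Config n → ℝ,
           IsMassiveWeakCorrector L FΘ (‖kv‖ ^ 2) Wre δre →
           IsMassiveWeakCorrector L FΘ (‖kv‖ ^ 2) Wim δim →
           ((n : ℝ) + 1) * ν m ≤
             C * (((n : ℝ) + 1) * ∫ Y in cellN n L, (δre Y ^ 2 + δim Y ^ 2) * ‖Θ.ψ Y‖ ^ 2)))

/-- The zero function is a massive weak corrector for the zero source (any weight, any mass). -/
theorem isMassiveWeakCorrector_zero {N : ℕ} (L : ℝ) (F : Config N → ℝ) (κ : ℝ) :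
    IsMassiveWeakCorrector L F κ (fun _ => 0) (fun _ => 0) := by
  refine ⟨IsPeriodicTest.const L 0, fun φ _ => ?_⟩
  simp

/-- **The stub forces `ν_m ≤ 0` at every Born zero.** If `LevyCorrectorDomination` holds then, for
every smooth-class `v`, eventually in `n`, for the positive minimisers `Ψ`, `Θ` and every mode
`m ≠ 0` whose wave vector `k = 2πm/L` is a real zero of the Born vertex (`vhat v k = 0`), the
crux's Lévy weight satisfies `ν_m ≤ 0` — specialise the stub at `δre = δim = 0`. -/
theorem levyWeight_nonpos_at_bornZero (h : LevyCorrectorDomination) :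
    ∀ v : ℝ → ℝ≥0∞, IsRepulsiveFiniteRange v → (∀ r, v r ≠ ⊤) →
    ContDiff ℝ 2 (fun x : Space => (v ‖x‖).toReal) →
    (∃ Cₑ : ℝ, ∀ x : Space, ‖iteratedFDeriv ℝ 2 (fun x : Space => (v ‖x‖).toReal) x‖ ≤
      Cₑ * Real.sqrt ((v ‖x‖).toReal)) →
    ∃ ρ₀ : ℝ, 0 < ρ₀ ∧ ∀ ρ : ℝ, 0 < ρ → ρ < ρ₀ → ∀ᶠ n : ℕ in atTop,
      ∀ Ψ : PeriodicTrialState (n + 1) (sideLength ρ (n + 1)),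
      ∀ Θ : PeriodicTrialState n (sideLength ρ (n + 1)),
      (let L : ℝ := sideLength ρ (n + 1)
       let g : Space → ℝ := fun r => ∫ x in cell L, ∫ Y in cellN n L,
         ‖Ψ.ψ (Matrix.vecCons (x + r) Y)‖ * ‖Ψ.ψ (Matrix.vecCons x Y)‖
       let ν : (Fin 3 → ℤ) → ℝ := fun m =>
         (cellFourierCoeff L (fun r : Space => ((Real.log (g r) : ℝ) : ℂ)) m).re
       periodicEnergy v Ψ = periodicGroundStateEnergy v (n + 1) L → periodicEnergy v Ψ ≠ ⊤ →
       (∀ X, Ψ.ψ X = (‖Ψ.ψ X‖ : ℂ)) → (∀ X, Ψ.ψ X ≠ 0) →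
       periodicEnergy v Θ = periodicGroundStateEnergy v n L → periodicEnergy v Θ ≠ ⊤ →
       (∀ Y, Θ.ψ Y = (‖Θ.ψ Y‖ : ℂ)) → (∀ Y, Θ.ψ Y ≠ 0) →
       ∀ m : Fin 3 → ℤ, m ≠ 0 →
         vhat v ((2 * Real.pi / L) • latticeVec 1 m) = 0 → ν m ≤ 0) := by
  intro v hv hfin hC2 hedge
  obtain ⟨C, _hC, ρ₀, hρ₀, H⟩ := h v hv hfin hC2 hedge
  refine ⟨ρ₀, hρ₀, fun ρ hρ hρ' => ?_⟩
  filter_upwards [H ρ hρ hρ'] with n hn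
  intro Ψ Θ
  dsimp only at hn ⊢
  intro h1 h2 h3 h4 h5 h6 h7 h8 m hm hzero
  have key := hn Ψ Θ h1 h2 h3 h4 h5 h6 h7 h8 m hm (fun _ => 0) (fun _ => 0) ?_ ?_
  · have hpos : (0 : ℝ) < (n : ℝ) + 1 := by positivity
    have key' : ((n : ℝ) + 1) *
        (cellFourierCoeff (sideLength ρ (n + 1)) (fun r : Space => ((Real.log
          (∫ x in cell (sideLength ρ (n + 1)), ∫ Y in cellN n (sideLength ρ (n + 1)),
            ‖Ψ.ψ (Matrix.vecCons (x + r) Y)‖ * ‖Ψ.ψ (Matrix.vecCons x Y)‖) : ℝ) : ℂ)) m).re ≤ 0 := by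
      simpa using key
    by_contra hcon
    have := mul_pos hpos (lt_of_not_ge hcon)
    linarith
  · -- real-part source vanishes at a Born zero
    refine ⟨IsPeriodicTest.const _ 0, fun φ _ => ?_⟩
    simp [hzero]
  · refine ⟨IsPeriodicTest.const _ 0, fun φ _ => ?_⟩
    simp [hzero]

end Summit.AtomisticToContinuum.BoseEinsteinCondensation.Cruxes.InfraredMinimumUncertainty.TriageR1K2
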